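import Literature.Geometry.Lorentzian.LorentzBoost
import HarnessLib

/-!
# Route ClusterCompleteness · crux `OmegaLimitMultiKerr` — the `1/4` anchor does not beat the
# Kerr–Schild margin near the horizon of a moving hole (a kernel-checked witness)

Structure lemma (a NEGATIVE interface certificate) for the crux stmt-FinalStateConjecture-14664
(`ClusterCompleteness.OmegaLimitMultiKerr`), line `Sketch`, lead gen 4, registered stub
`exists_boosted_margin_le_eighth` (closed form).

The recur-disjunct `Recurs k 𝒟` of the crux (`ClusterCompletenessOmegaLimitMultiKerrDefs`) carries
an all-time `C⁰` ANCHOR on every hole chart, `‖Ψ^* 𝐠(x) − g_{M,a,Λ,c}(x)‖ ≤ 1/4` (operator norm in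
the Euclidean coordinates of `E4`), and the line certifies nondegeneracy of anchored (limit) chart
metrics `G + g_{M,a,Λ,c}(x)` where the nondegeneracy MARGIN of the reference form
`g_{M,a,Λ,c}(x) = boostedKerrBilin Λ c M a x` — the largest `m` with `m‖v‖ ≤ ‖g_{M,a,Λ,c}(x)(v, ·)‖`
for all `v` — exceeds the anchor (`…LimitIsMetric`, `isInvertible_add_of_norm_lt_margin`). This file
is the kernel-checked witness that near the horizon of a MOVING hole the margin drops below the
anchor, so that there the absolute `C⁰` anchor certifies nothing:

* `exists_boostedKerrBilin_apply_eq_neg_eighth` — the explicit computation. Schwarzschild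
  `M = 1`, `a = 0`, boosted by the pure boost `Λ` of lab velocity `u = (3/5, 0, 0)` (`γ = 5/4`,
  `Λ(y⁰, y¹, y², y³) = ((5y⁰ + 3y¹)/4, (3y⁰ + 5y¹)/4, y², y³)`), centre `c = 0`; rest-frame point
  `y = (0, −128/63, 0, 0)` of radius `r = 128/63 > 2 = r₊` (so `H = 1/r = 63/128`,
  `ℓ = dx⁰ − dx¹`), lab point `x = Λy`; lab direction `e = (9, 7, 0, 0) = Λ(6, 2, 0, 0)`. Then
  `g_{1,0,Λ,0}(x)(e, w) = −(9w⁰ + 7w¹)/8 = −⟪e, w⟫/8` for every `w` (`e` is an exact eigenvector,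
  eigenvalue `−1/8`, of the Gram matrix of the boosted form; the other eigenvalues are `8, 1, 1`);
* `exists_boosted_margin_le_eighth` (MAIN, registered) — hence
  `‖g_{1,0,Λ,0}(x)(e, ·)‖ ≤ (1/8)‖e‖`, `e ≠ 0`: the margin of the boosted Schwarzschild reference at
  a point of the open boosted exterior is `≤ 1/8 < 1/4`;
* `exists_boosted_perturbation_degenerate` — the explicit symmetric perturbation
  `P = (1/1040) ⟪e, ·⟫ ⊗ ⟪e, ·⟫` has `‖P‖ ≤ 1/8` and `(g_{1,0,Λ,0}(x) + P)(e, ·) = 0`;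
* `exists_boosted_perturbation_not_isInvertible` — so `g_{1,0,Λ,0}(x) + P` is NOT invertible
  (an invertible map is injective).

Reading: a `1/4`-anchored (indeed `1/8`-anchored) chart value can be degenerate near the horizon of
a hole receding at speed `3/5`; the crux's absolute `C⁰` anchor certifies nondegeneracy (immersed
chart, Lorentzian chart metric) only where the Kerr–Schild margin exceeds `1/4` — at rest the
margin is `≥ 1/3` on the whole Schwarzschild exterior
(`SublinearIsFree.Slaving.norm_le_mul_norm_boostedKerrBilin`), but it is NOT Lorentz invariant,
the Euclidean norm of `E4` being frame dependent. Everything is proved; Mathlib + `Literature`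
only (`Lorentz.boost`, `Lorentz.minkowski_boostCLM`, `Kerr.bilin_apply`); no definitions. The
inverse boost is never computed: `η(e', Λ⁻¹w) = η(Λe', w)` (Lorentz invariance) and
`ℓ_y(Λ⁻¹w) = η(n, Λ⁻¹w) = η(Λn, w)` with `n = (−1, −1, 0, 0)`, `Λn = (−2, −2, 0, 0)`.
-/

-- every `Summit.FinalStateConjecture.FinalStateConjecture.…` name repeats the summit = sub-problem segment (D-0017 layout)
set_option linter.dupNamespace false

noncomputable section

namespace Summit.FinalStateConjecture.FinalStateConjecture.Theorems.ClusterCompleteness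

open Literature.Geometry.Lorentzian

/-! ### The explicit near-horizon eigenvector of the boosted Schwarzschild form -/

/-- **The boosted Schwarzschild form has an exact `−1/8` eigendirection near the horizon.** There
are a Lorentz transformation `Λ` (the pure boost of lab velocity `(3/5, 0, 0)`), a point `x` of the
boosted Schwarzschild exterior `boostedKerrExterior Λ 0 1 0` (rest-frame coordinates
`(0, −128/63, 0, 0)`, radius `128/63 > 2 = r₊`) and a vector `e = (9, 7, 0, 0)` (`‖e‖² = 130`,
`⟪e, w⟫ = 9w⁰ + 7w¹`) with `boostedKerrBilin Λ 0 1 0 x e w = −(9w⁰ + 7w¹)/8` for all `w`: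
with `e = Λe'`, `e' = (6, 2, 0, 0)`, `H = 63/128`, `ℓ = dx⁰ − dx¹` at the rest-frame point,
`g(Λ⁻¹e, Λ⁻¹w) = η(e', Λ⁻¹w) + 2Hℓ(e')ℓ(Λ⁻¹w) = η(e, w) + (63/16)(2w⁰ − 2w¹) = −(9w⁰ + 7w¹)/8`
(Lorentz covariance of the Kerr–Schild ansatz, Kerr–Schild 1965, §3; boost formulas O'Neill 1983,
Ch. 9, pp. 233–236). [cite: KerrSchild1965, §3] -/
theorem exists_boostedKerrBilin_apply_eq_neg_eighth :
    ∃ (Λ : lorentzGroup) (x e : E4), x ∈ boostedKerrExterior Λ 0 1 0 ∧ ‖e‖ ^ 2 = 130 ∧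
      (∀ w : E4, inner ℝ e w = 9 * w 0 + 7 * w 1) ∧
      ∀ w : E4, boostedKerrBilin Λ 0 1 0 x e w = -(1 / 8) * (9 * w 0 + 7 * w 1) := by
  -- the lab velocity `u = (3/5, 0, 0)`, `‖u‖ = 3/5`, `γ = 5/4`
  obtain ⟨u, hu0, hu1, hu2⟩ : ∃ u : E3, u 0 = 3 / 5 ∧ u 1 = 0 ∧ u 2 = 0 :=
    ⟨WithLp.toLp 2 ![3 / 5, 0, 0], rfl, rfl, rfl⟩
  have hu2' : ‖u‖ ^ 2 = 9 / 25 := by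
    rw [EuclideanSpace.real_norm_sq_eq, Fin.sum_univ_three, hu0, hu1, hu2]
    norm_num
  have hu : ‖u‖ < 1 := by nlinarith [norm_nonneg u]
  have hγ : Lorentz.gamma u = 5 / 4 := by
    unfold Lorentz.gamma
    rw [hu2', show (1 : ℝ) - 9 / 25 = (4 / 5) ^ 2 by norm_num, Real.sqrt_sq (by norm_num)]
    norm_num
  have hin : ∀ y : E4, inner ℝ u (E4.spatial y) = 3 / 5 * y 1 := fun y ↦ by
    simp [PiLp.inner_apply, Fin.sum_univ_three, hu0, hu1, hu2]
    ring
  -- the boost in components: `Λ y = ((5y⁰ + 3y¹)/4, (3y⁰ + 5y¹)/4, y², y³)`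
  have hΛ0 : ∀ y : E4, Lorentz.boostCLM u y 0 = (5 * y 0 + 3 * y 1) / 4 := fun y ↦ by
    rw [Lorentz.boostCLM_apply_zero, hγ, hin]
    ring
  have hΛ1 : ∀ y : E4, Lorentz.boostCLM u y 1 = (3 * y 0 + 5 * y 1) / 4 := fun y ↦ by
    have h := congrArg (fun z : E3 ↦ z 0) (Lorentz.spatial_boostCLM_apply u y)
    simp only [E4.spatial_apply, PiLp.add_apply, PiLp.smul_apply, smul_eq_mul,
      Fin.succ_zero_eq_one] at h
    rw [h, hγ, hin, hu0]
    ring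
  have hΛ2 : ∀ y : E4, Lorentz.boostCLM u y 2 = y 2 := fun y ↦ by
    have h := congrArg (fun z : E3 ↦ z 1) (Lorentz.spatial_boostCLM_apply u y)
    simp only [E4.spatial_apply, PiLp.add_apply, PiLp.smul_apply, smul_eq_mul,
      Fin.succ_one_eq_two] at h
    rw [h, hu1, mul_zero, add_zero]
  have hΛ3 : ∀ y : E4, Lorentz.boostCLM u y 3 = y 3 := fun y ↦ by
    have h := congrArg (fun z : E3 ↦ z 2) (Lorentz.spatial_boostCLM_apply u y)
    simp only [E4.spatial_apply, PiLp.add_apply, PiLp.smul_apply, smul_eq_mul] at h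
    rw [show ((2 : Fin 3).succ : Fin 4) = 3 from rfl] at h
    rw [h, hu2, mul_zero, add_zero]
  have hΛsymm : ∀ w : E4,
      Lorentz.boostCLM u ((Lorentz.boost u hu : E4 ≃L[ℝ] E4).symm w) = w := fun w ↦ by
    rw [← Lorentz.coe_boost_apply hu]
    exact (Lorentz.boost u hu : E4 ≃L[ℝ] E4).apply_symm_apply w
  -- `Λ(6, 2, 0, 0) = (9, 7, 0, 0)` and `Λ(−1, −1, 0, 0) = (−2, −2, 0, 0)`
  have he : Lorentz.boostCLM u (WithLp.toLp 2 ![6, 2, 0, 0]) = WithLp.toLp 2 ![9, 7, 0, 0] := by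
    ext i
    fin_cases i
    · simp [hΛ0]; norm_num
    · simp [hΛ1]; norm_num
    · simp [hΛ2]
    · simp [hΛ3]
  have hn : Lorentz.boostCLM u (WithLp.toLp 2 ![-1, -1, 0, 0]) =
      WithLp.toLp 2 ![-2, -2, 0, 0] := by
    ext i
    fin_cases i
    · simp [hΛ0]; norm_num
    · simp [hΛ1]; norm_num
    · simp [hΛ2]
    · simp [hΛ3]
  -- the rest-frame point `y = (0, −128/63, 0, 0)`: `r = 128/63`, `H = 63/128`, `ℓ = dx⁰ − dx¹`
  obtain ⟨y, hy1, hy2, hy3⟩ : ∃ y : E4, y 1 = -128 / 63 ∧ y 2 = 0 ∧ y 3 = 0 :=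
    ⟨WithLp.toLp 2 ![0, -128 / 63, 0, 0], rfl, rfl, rfl⟩
  have hr : Kerr.radius 0 y = 128 / 63 := by
    rw [Kerr.radius_zero_left]
    have h := E4.spatialNorm_sq y
    rw [hy1, hy2, hy3] at h
    nlinarith [E4.spatialNorm_nonneg y]
  have hH : Kerr.scalarH 1 0 y = 63 / 128 := by
    unfold Kerr.scalarH
    rw [hr, hy3]
    norm_num
  have hℓ : ∀ z : E4, Kerr.nullCovector 0 y z = z 0 - z 1 := fun z ↦ by
    simp [Kerr.nullCovector, Kerr.nullCovectorFun, Fin.sum_univ_four, hr, hy1, hy2, hy3]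
    ring
  refine ⟨Lorentz.boost u hu, (Lorentz.boost u hu : E4 ≃L[ℝ] E4) y, WithLp.toLp 2 ![9, 7, 0, 0],
    ?_, ?_, fun w ↦ ?_, fun w ↦ ?_⟩
  · -- `x = Λ y` lies in the boosted exterior: `Λ⁻¹(x − 0) = y`, `r(y) = 128/63 > 2 = r₊`
    rw [mem_boostedKerrExterior, poincareInv, sub_zero, ContinuousLinearEquiv.symm_apply_apply,
      Kerr.mem_exterior, hr, Kerr.rPlus_zero_right zero_le_one]
    norm_num
  · rw [EuclideanSpace.real_norm_sq_eq, Fin.sum_univ_four]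
    simp
    norm_num
  · simp [PiLp.inner_apply, Fin.sum_univ_four]
    ring
  · -- `g_{1,0,Λ,0}(Λy)(e, w) = g_{1,0}(y)(e', Λ⁻¹w)`, `e' = (6, 2, 0, 0)`
    have he' : (Lorentz.boost u hu : E4 ≃L[ℝ] E4).symm (WithLp.toLp 2 ![9, 7, 0, 0]) =
        WithLp.toLp 2 ![6, 2, 0, 0] := by
      rw [← he, ← Lorentz.coe_boost_apply hu, ContinuousLinearEquiv.symm_apply_apply]
    -- Lorentz invariance: `η(e', Λ⁻¹w) = η(Λe', w) = η(e, w)`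
    have h1 : Minkowski.bilin (WithLp.toLp 2 ![6, 2, 0, 0])
        ((Lorentz.boost u hu : E4 ≃L[ℝ] E4).symm w) = -(9 * w 0) + 7 * w 1 := by
      rw [← Lorentz.minkowski_boostCLM hu, hΛsymm, he]
      simp [Minkowski.bilin_apply, Fin.sum_univ_three]
    -- `ℓ(Λ⁻¹w) = η(n, Λ⁻¹w) = η(Λn, w) = 2w⁰ − 2w¹`, `n = (−1, −1, 0, 0)`
    have h2 : ((Lorentz.boost u hu : E4 ≃L[ℝ] E4).symm w) 0 -
        ((Lorentz.boost u hu : E4 ≃L[ℝ] E4).symm w) 1 = 2 * w 0 - 2 * w 1 := by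
      have h := Lorentz.minkowski_boostCLM hu (WithLp.toLp 2 ![-1, -1, 0, 0])
        ((Lorentz.boost u hu : E4 ≃L[ℝ] E4).symm w)
      rw [hΛsymm, hn] at h
      simp [Minkowski.bilin_apply, Fin.sum_univ_three] at h
      linarith
    have h3 : Kerr.nullCovector 0 y (WithLp.toLp 2 ![6, 2, 0, 0]) = 4 := by
      rw [hℓ]
      norm_num
    rw [boostedKerrBilin_apply, poincareInv, sub_zero, ContinuousLinearEquiv.symm_apply_apply, he',
      Kerr.bilin_apply, hH, h3, hℓ, h1, h2]
    ring

/-! ### The margin of the boosted reference drops below the anchor -/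

/-- **Near the horizon of a hole boosted at speed `3/5` the nondegeneracy margin of the reference
form is `≤ 1/8 < 1/4`** (registered structure stub of line `Sketch`, crux
stmt-FinalStateConjecture-14664, closed form; a NEGATIVE interface certificate). There are a
Lorentz transformation `Λ`, a subextremal Schwarzschild label `(M, 0)` and a point `x` of the open
boosted exterior `boostedKerrExterior Λ 0 M 0` at which some `v ≠ 0` has
`‖boostedKerrBilin Λ 0 M 0 x v‖ ≤ (1/8)‖v‖`: by `exists_boostedKerrBilin_apply_eq_neg_eighth`,
`g(x)(e, w) = −⟪e, w⟫/8`, so `|g(x)(e, w)| ≤ (1/8)‖e‖‖w‖` (Cauchy–Schwarz). Reading: the crux's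
absolute `C⁰` anchor `‖Ψ^* 𝐠 − g_{M,a,Λ,c}‖ ≤ 1/4` certifies nondegeneracy of the chart metric only
where the Kerr–Schild margin exceeds `1/4`; at rest the margin is `≥ 1/3` on the whole
Schwarzschild exterior (`SublinearIsFree.Slaving.norm_le_mul_norm_boostedKerrBilin`), but for a hole
receding at speed `3/5` it is `≤ 1/8` near the horizon. [folklore] -/
theorem exists_boosted_margin_le_eighth :
    ∃ (Λ : lorentzGroup) (M : ℝ) (x : E4), Kerr.IsSubextremal M 0 ∧
      x ∈ boostedKerrExterior Λ 0 M 0 ∧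
      ∃ v : E4, v ≠ 0 ∧ ‖boostedKerrBilin Λ 0 M 0 x v‖ ≤ 1 / 8 * ‖v‖ := by
  obtain ⟨Λ, x, e, hx, hnorm, hinner, hB⟩ := exists_boostedKerrBilin_apply_eq_neg_eighth
  have hM : Kerr.IsSubextremal 1 0 := by
    unfold Kerr.IsSubextremal
    norm_num
  refine ⟨Λ, 1, x, hM, hx, e, fun h ↦ ?_, ?_⟩
  · rw [h, norm_zero] at hnorm
    norm_num at hnorm
  · refine ContinuousLinearMap.opNorm_le_bound _ (by positivity) fun w ↦ ?_
    rw [hB, ← hinner, Real.norm_eq_abs, abs_mul, abs_neg,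
      abs_of_pos (by norm_num : (0 : ℝ) < 1 / 8), mul_assoc]
    exact mul_le_mul_of_nonneg_left (abs_real_inner_le_norm e w) (by norm_num)

/-- **A symmetric perturbation of norm `≤ 1/8` makes the boosted reference degenerate near the
horizon.** With `Λ`, `M = 1`, `x`, `e = (9, 7, 0, 0)` as in
`exists_boostedKerrBilin_apply_eq_neg_eighth`, the symmetric form
`P = (1/1040) (9dx⁰ + 7dx¹) ⊗ (9dx⁰ + 7dx¹) = (1/1040) ⟪e, ·⟫⟪e, ·⟫` has
`|P(v, w)| ≤ ‖e‖²‖v‖‖w‖/1040 = (1/8)‖v‖‖w‖` and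
`(boostedKerrBilin Λ 0 1 0 x + P)(e, w) = −⟪e, w⟫/8 + (130/1040)⟪e, w⟫ = 0`: a `1/8`-anchored
(a fortiori `1/4`-anchored) chart value `G + g_{M,a,Λ,c}(x)`, `‖G‖ ≤ 1/8`, can be degenerate at a
point of the boosted exterior. [folklore] -/
theorem exists_boosted_perturbation_degenerate :
    ∃ (Λ : lorentzGroup) (M : ℝ) (x : E4) (P : E4 →L[ℝ] E4 →L[ℝ] ℝ), Kerr.IsSubextremal M 0 ∧
      x ∈ boostedKerrExterior Λ 0 M 0 ∧ ‖P‖ ≤ 1 / 8 ∧ (∀ v w : E4, P v w = P w v) ∧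
      ∃ v : E4, v ≠ 0 ∧ (boostedKerrBilin Λ 0 M 0 x + P) v = 0 := by
  obtain ⟨Λ, x, e, hx, hnorm, hinner, hB⟩ := exists_boostedKerrBilin_apply_eq_neg_eighth
  have hM : Kerr.IsSubextremal 1 0 := by
    unfold Kerr.IsSubextremal
    norm_num
  have hP : ∀ v w : E4, ((1 / 1040 : ℝ) •
      E4.tmul (E4.covector ![9, 7, 0, 0]) (E4.covector ![9, 7, 0, 0])) v w =
        1 / 1040 * (inner ℝ e v * inner ℝ e w) := fun v w ↦ by
    rw [hinner, hinner]
    simp [Fin.sum_univ_four]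
  have hee : inner ℝ e e = 130 := by rw [real_inner_self_eq_norm_sq, hnorm]
  refine ⟨Λ, 1, x, (1 / 1040 : ℝ) • E4.tmul (E4.covector ![9, 7, 0, 0]) (E4.covector ![9, 7, 0, 0]),
    hM, hx, ?_, fun v w ↦ ?_, e, fun h ↦ ?_, ?_⟩
  · -- `‖P‖ ≤ 1/8`: `|P(v, w)| ≤ ‖e‖²‖v‖‖w‖/1040`
    refine ContinuousLinearMap.opNorm_le_bound _ (by norm_num) fun v ↦ ?_
    refine ContinuousLinearMap.opNorm_le_bound _ (by positivity) fun w ↦ ?_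
    rw [hP, Real.norm_eq_abs, abs_mul, abs_mul, abs_of_pos (by norm_num : (0 : ℝ) < 1 / 1040)]
    have h : |inner ℝ e v| * |inner ℝ e w| ≤ ‖e‖ * ‖v‖ * (‖e‖ * ‖w‖) :=
      mul_le_mul (abs_real_inner_le_norm e v) (abs_real_inner_le_norm e w) (abs_nonneg _)
        (by positivity)
    calc 1 / 1040 * (|inner ℝ e v| * |inner ℝ e w|) ≤ 1 / 1040 * (‖e‖ * ‖v‖ * (‖e‖ * ‖w‖)) :=
        mul_le_mul_of_nonneg_left h (by norm_num)
      _ = 1 / 1040 * ‖e‖ ^ 2 * (‖v‖ * ‖w‖) := by ring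
      _ = 1 / 8 * ‖v‖ * ‖w‖ := by rw [hnorm]; ring
  · rw [hP, hP, mul_comm (inner ℝ e v)]
  · rw [h, norm_zero] at hnorm
    norm_num at hnorm
  · ext w
    rw [add_apply, add_apply, hB, hP, hee, hinner, zero_apply]
    ring

/-- **Hence a `1/8`-small symmetric perturbation of the boosted reference can fail to be
invertible**: with `Λ`, `M`, `x`, `P` as in `exists_boosted_perturbation_degenerate`,
`boostedKerrBilin Λ 0 M 0 x + P` kills a nonzero vector, so it is not invertible as a map
`E4 → E4*` (an invertible continuous linear map is injective). This is the sharpness of the margin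
hypothesis `‖P‖ < m` in `isInvertible_add_of_norm_lt_margin` (`…LimitIsMetric`; O'Neill 1983,
Ch. 3, Lemma 3.4) against the crux's anchor `1/4`. [cite: ONeill1983, Ch. 3 Lemma 3.4] -/
theorem exists_boosted_perturbation_not_isInvertible :
    ∃ (Λ : lorentzGroup) (M : ℝ) (x : E4) (P : E4 →L[ℝ] E4 →L[ℝ] ℝ), Kerr.IsSubextremal M 0 ∧
      x ∈ boostedKerrExterior Λ 0 M 0 ∧ ‖P‖ ≤ 1 / 8 ∧ (∀ v w : E4, P v w = P w v) ∧
      ¬ (boostedKerrBilin Λ 0 M 0 x + P).IsInvertible := by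
  obtain ⟨Λ, M, x, P, hM, hx, hP, hPs, v, hv, hv0⟩ := exists_boosted_perturbation_degenerate
  exact ⟨Λ, M, x, P, hM, hx, hP, hPs, fun h ↦ hv (h.injective (hv0.trans (map_zero _).symm))⟩

end Summit.FinalStateConjecture.FinalStateConjecture.Theorems.ClusterCompleteness

end
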